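import Summits.FinalStateConjecture.FinalStateConjecture.Theses.BartnikGapSettling
import Summits.FinalStateConjecture.FinalStateConjecture.Theorems.GapExhaustion.Negative.GapExhaustionFalseOfFarWildBlackHole
import Summits.FinalStateConjecture.FinalStateConjecture.Theorems.BartnikGapSettlingGapExhaustionOfJunkCollars
import Literature.Geometry.Lorentzian.NearKerrCollarCore
import Literature.Geometry.Lorentzian.CollarMargin

/-!
# STRATEGY_r1 — typed companion of the r1 (redirect) crux-strategist census for `GapExhaustion`

Crux: `Summit.FinalStateConjecture.FinalStateConjecture.Theses.BartnikGapSettling.GapExhaustion`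
(item `stmt-FinalStateConjecture-10808`, route `BartnikGapSettling`, rev 6). Seat
`planner-cstrat-stmt-FinalStateConjecture-10808-r1-0` (REDIRECT r1, 2026-08-17), working beside — never
on — the lead's files. Companion prose: `STRATEGY-CENSUS.md` (r1 pass prepended to s2/s1).

Contents (pure logic over LANDED declarations; nothing here asserts the truth of any item):

* §0 the closing certificate BY NAME — kernel re-check that the theorems the census cites have the
  cited shapes: the filed text is FALSE modulo `FarWildBlackHoleExists` (p108531) and TRUE modulo the
  global junk-collar hypothesis (p106860/p116015), and the two construction hypotheses are mutually
  inconsistent (`not_farWildBlackHoleExists_of_junkCollars`), so the filed text is decided by WHICH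
  construction holds, not by any settling mathematics — the signature of a MISSTATED item;
* §1 `## Decomposition` (r1): every typed split of the FILED decl into ANY family of pieces with a
  proved assembly inherits a piece that is false modulo `FarWildBlackHoleExists`
  (`split_inherits_false_piece`, the index-free form of s1's three-piece lemma), and a split all of
  whose pieces are theorems is a refutation of `FarWildBlackHoleExists`
  (`split_all_proved_refutes_farWild`);
* §2 `## Strengthen` (r1): the Dafermos–Rodnianski `rᵖ`-HIERARCHY form `RpHierarchyExhaustion` of the
  crux's energy half, typed over `NearKerrCollarCore` / `collarCore` / `HasCutBondiMass` with the
  collar chart's own Kerr-star clock as the unit of advance, plus the abstract pigeonhole it buys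
  (`tendsto_zero_of_hierarchy`: a two-level summable hierarchy forces the bottom weight to zero) —
  the "induction on weights" that distinguishes this S⁺ from s2's Lyapunov form and s1's Łojasiewicz
  form; WHY IT BUYS NOTHING for this step is recorded in its docstring and in the census.
-/

noncomputable section

-- D-0017: single-problem summit, `Summit.<S>.<S>.…` by design (cf. lakefile `weak.linter.dupNamespace`).
set_option linter.dupNamespace false

namespace Summit.FinalStateConjecture.FinalStateConjecture.Cruxes.GapExhaustion.StrategyR1

open Literature.Geometry.Lorentzian
open Set Filter Topology
open scoped Manifold ContDiff Topology ENNReal BigOperators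

open Summit.FinalStateConjecture.FinalStateConjecture.Theses.BartnikGapSettling (GapExhaustion)
open Summit.FinalStateConjecture.FinalStateConjecture.Theorems
  (GapExhaustion_of_junkCollars not_farWildBlackHoleExists_of_junkCollars)
open Summit.FinalStateConjecture.FinalStateConjecture.Theorems.GapExhaustion.Negative
  (FarWildBlackHoleExists GapExhaustion_false_of_farWildBlackHoleExists)

/-! ## §0 The closing certificate, by name -/

/-- p108531 (refuter c2 / prover formalisation): the filed text is false modulo the far-wild
black-hole construction hypothesis `FarWildBlackHoleExists` ((W) no quiet order-3 collar beyond a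
compact set ∧ (F) a positive floor on the cut Bondi energy of late point cones ∧ (C) admissible
competitors of arbitrarily small energy). [folklore] -/
example : FarWildBlackHoleExists → ¬ GapExhaustion :=
  GapExhaustion_false_of_farWildBlackHoleExists

/-- p106860 / p116015: there is a construction hypothesis `J` (junk sub-extremal collars of
prescribed `δ`-closeness beyond every compact set of EVERY maximal admissible development — the
hypothesis of `GapExhaustion_of_junkCollars`) under which the filed text holds VACUOUSLY (its margin
hypothesis fails everywhere). [folklore] -/
example : ∃ J : Prop, (J → GapExhaustion) := ⟨_, GapExhaustion_of_junkCollars⟩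

/-- The two construction hypotheses filed against the crux are mutually inconsistent (landed as
`not_farWildBlackHoleExists_of_junkCollars`): the filed text is decided by WHICH of two chart
constructions succeeds on far-wild developments — a question about `Cᵏ` chart-fitting at low far-field
regularity, not about settling to Kerr. [folklore] -/
example : ∃ J : Prop, (J → GapExhaustion) ∧ (J → ¬ FarWildBlackHoleExists) :=
  ⟨_, GapExhaustion_of_junkCollars, not_farWildBlackHoleExists_of_junkCollars⟩

/-! ## §1 `## Decomposition` (r1): any split of the filed decl inherits a false piece -/

/-- **Every typed split of the FILED decl inherits a believed-false piece.** For ANY index type and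
ANY family of pieces `P i` with a proved assembly `(∀ i, P i) → GapExhaustion`, the far-wild
hypothesis refutes some piece. (s1 proved the three-piece curried instance
`filed_split_inherits_false_piece`; this is the index-free form: the number and the cut of the pieces
are irrelevant.) Consequence for output (b) of the strategist protocol: no split of the filed text has
"every open piece planned" — the inherited piece can only be closed by refuting it, which is the
open-in-print rough large-data stability problem recorded in the census `## Negation`. [folklore] -/
theorem split_inherits_false_piece {ι : Sort*} (P : ι → Prop) (hglue : (∀ i, P i) → GapExhaustion)
    (H : FarWildBlackHoleExists) : ∃ i, ¬ P i := by
  by_contra h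
  push Not at h
  exact GapExhaustion_false_of_farWildBlackHoleExists H (hglue h)

/-- Contrapositive reading: a split of the filed decl ALL of whose pieces get proved is, verbatim, a
refutation of `FarWildBlackHoleExists` — i.e. a proof that far-wild admissible black-hole data with
complete `𝓘⁺`, a Bondi floor and small competitors do not exist, which nobody believes. [folklore] -/
theorem split_all_proved_refutes_farWild {ι : Sort*} (P : ι → Prop)
    (hglue : (∀ i, P i) → GapExhaustion) (hall : ∀ i, P i) : ¬ FarWildBlackHoleExists :=
  fun H => (split_inherits_false_piece P hglue H).elim fun i hi => hi (hall i)

/-! ## §2 `## Strengthen` (r1): the `rᵖ`-hierarchy form and the pigeonhole it buys -/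

section Sectors

variable {X : Type} [TopologicalSpace X] [ChartedSpace E3 X] [IsManifold (𝓡 3) ∞ X]
  [ConnectedSpace X]

/-- **R7: far-regular data** (verbatim `StrategyS2.IsFarRegular` / `RestatedS1.IsFarRegular`, which a
crux workfile cannot import): strongly asymptotically flat at the Dafermos–Rodnianski rates to EVERY
derivative order on a sole end. [folklore] -/
def IsFarRegular (D : InitialDataSet (𝓡 3) X) : Prop :=
  ∀ n : ℕ, ∃ (e : AFEnd X) (M : ℝ), e.IsSoleEnd ∧ e.IsStronglyAsymptoticallyFlatWith D M 1 2 n n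

end Sectors

/-- **S⁺ᵣ₁ `RpHierarchyExhaustion`** — the `rᵖ`-HIERARCHY form of the crux's energy half (the move of
Dafermos–Rodnianski, "A new physical-space approach to decay for the wave equation", arXiv:0910.4957,
§1: a finite family of weighted energies `E_p`, the top one BOUNDED, each lower one INTEGRABLE in time
against the next one up, whence decay of the bottom one by pigeonhole on dyadic intervals — an
induction on the weight `p`, which is the rigidity this S⁺ adds). On every maximal far-regular
development with complete `𝓘⁺`: weighted energies `E 0, E 1, E 2` on subsets (read on cores) with
(i) `E 2` finite on late cores; (ii) the HIERARCHY along every chain of windowed `δ'`-collared one-hole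
cores each lying to the causal future of the Kerr-star-time-ONE slab of the previous collar chart (the
chart's own clock is the unit of advance, so the sum is an honest time integral and a constant chain
is excluded): `∑_{m>n} E p (coreₘ) ≤ E (p+1) (coreₙ)` for `p = 0, 1`; (iii) COERCIVITY: `E 0`
dominates the own-energy excess `m − Σ Mᵢ` of every windowed `δ`-collared `N ≤ 1` core, `δ ≤ δ'`
(verbatim the coercivity clause of `StrategyS2.LyapunovExhaustion`). By `tendsto_zero_of_hierarchy`
below, (i)+(ii)+(iii) force the own-energy excess to `0` along every such chain — own-energy
exhaustion with the chain as the witness sequence.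
WHY IT BUYS NOTHING FOR THIS STEP (census `## Strengthen`, r1): (ii) at `p = 0` is an INTEGRATED
LOCAL ENERGY DECAY statement for the full nonlinear flow on the exterior of late collars of an
UNKNOWN large-data geometry, and (i) is the top-order `rᵖ` flux bound at `𝓘⁺`; in print both exist
only (a) for LINEAR fields on a FIXED sub-extremal Kerr exterior (DR arXiv:0910.4957; DRSR
arXiv:1402.7034) or (b) for the nonlinear flow in the PERTURBATIVE regime (DHRT arXiv:2104.08222, KS,
Shen arXiv:2211.15230 §1.4 for the exterior), where trapping is that of the known background; for
large data an integrated decay estimate must survive whatever trapping the late geometry has, and a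
stably trapped null geodesic outside the collars defeats every polynomial rate (Keir, CQG 33 (2016)
135009, Thm 4.7; barrier `TrappingDerivativeLoss`) — the same wall at which s2's transfer breaks (T3)
and which s1's `FluxDominatedOwnEnergy` relocates; and `E`'s very definition presupposes the
foliation by late collared leaves, i.e. piece `LateCollaredLeavesC4`. Different inventory
(pigeonhole on weights vs LaSalle vs Łojasiewicz), same missing input. Typed for the census; not
filed. [folklore] -/
def RpHierarchyExhaustion : Prop :=
  ∀ (X : Type) [TopologicalSpace X] [ChartedSpace E3 X] [IsManifold (𝓡 3) ∞ X] [T2Space X]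
    [SecondCountableTopology X] [ConnectedSpace X], ∀ D ∈ admissibleVacuumData X,
    IsFarRegular D → ∀ 𝒟 : VacuumCauchyDevelopment D, 𝒟.IsMaximal →
      Summit.FinalStateConjecture.HasCompleteNullInfinity 𝒟.toCauchyDevelopment →
      ∀ (m₀ χ : ℝ) (k : ℕ), 0 < m₀ → χ < 1 →
        ∃ (E : ℕ → Set 𝒟.carrier → ℝ≥0∞) (δ' : ℝ≥0∞) (K' : Set 𝒟.carrier),
          0 < δ' ∧ IsCompact K' ∧
          -- (i) the top weight is finite on late sets
          (∀ C : Set 𝒟.carrier,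
            Disjoint (𝒟.metric.causalFuture 𝒟.timeOrientation C)
              (𝒟.metric.causalPast 𝒟.timeOrientation K') → E 2 C < ⊤) ∧
          -- (ii) the hierarchy along unit-advanced chains of windowed δ'-collared one-hole cores
          (∀ (M a : ℕ → Fin 1 → ℝ) (S : ℕ → Set 𝒟.carrier) (pt : ℕ → 𝒟.carrier)
            (mo : ℕ → Fin 1 → lorentzGroup × E4) (B : ℕ → Fin 1 → ModelBackground)
            (Φ : ∀ n i, (B n i).domain → 𝒟.carrier),
            (∀ n i, m₀ ≤ M n i ∧ M n i ≤ m₀⁻¹ ∧ |a n i| ≤ χ * M n i) →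
            (∀ n i, pt n ∈ Φ n i '' (B n i).truncTimeSlab (3 * M n i) 0) →
            (∀ n, 𝒟.NearKerrCollarCore k δ' 0 1 (M n) (a n) (S n) (pt n) (mo n) (B n) (Φ n)) →
            (∀ n, collarCore (M (n + 1)) (pt (n + 1)) (B (n + 1)) (Φ (n + 1)) ⊆
              𝒟.metric.causalFuture 𝒟.timeOrientation
                (Φ n 0 '' (B n 0).truncTimeSlab (3 * M n 0) 1)) →
            Disjoint (𝒟.metric.causalFuture 𝒟.timeOrientation
                (collarCore (M 0) (pt 0) (B 0) (Φ 0)))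
              (𝒟.metric.causalPast 𝒟.timeOrientation K') →
            ∀ p : ℕ, p < 2 → ∀ n : ℕ,
              (∑' j : ℕ, E p (collarCore (M (n + j + 1)) (pt (n + j + 1)) (B (n + j + 1))
                (Φ (n + j + 1)))) ≤ E (p + 1) (collarCore (M n) (pt n) (B n) (Φ n))) ∧
          -- (iii) coercivity: `E 0` dominates the own-energy excess of windowed δ-collared N ≤ 1 cores
          (∀ (δ : ℝ≥0∞) (N : ℕ) (M a : Fin N → ℝ) (S : Set 𝒟.carrier) (p : 𝒟.carrier)
            (mo : Fin N → lorentzGroup × E4) (B : Fin N → ModelBackground)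
            (Φ : ∀ i, (B i).domain → 𝒟.carrier) (m : ℝ), δ ≤ δ' → N ≤ 1 →
            (∀ i, m₀ ≤ M i ∧ M i ≤ m₀⁻¹ ∧ |a i| ≤ χ * M i) →
            (∀ i, p ∈ Φ i '' (B i).truncTimeSlab (3 * M i) 0) →
            𝒟.NearKerrCollarCore k δ 0 N M a S p mo B Φ →
            𝒟.toCauchyDevelopment.HasCutBondiMass (collarCore M p B Φ) m →
            ENNReal.ofReal (m - ∑ i, M i) ≤ E 0 (collarCore M p B Φ))

/-- **The pigeonhole the hierarchy buys** (abstract form of DR arXiv:0910.4957, §1, the dyadic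
argument): if a top quantity `E₂` is finite, the middle weights are summable against it along the
chain, and every tail of the bottom weights is summable against the middle weight at the tail's
start, then the bottom weight tends to `0` along the chain. Applied to a chain as in clause (ii) of
`RpHierarchyExhaustion` (`E₂ := E 2 core₀`, `E₁ n := E 1 coreₙ`, `E₀ n := E 0 coreₙ`) and composed
with the coercivity (iii), it gives own-energy exhaustion along the chain. [folklore] -/
theorem tendsto_zero_of_hierarchy (E₀ E₁ : ℕ → ℝ≥0∞) (E₂ : ℝ≥0∞) (hfin : E₂ ≠ ⊤)
    (h₁ : ∑' j, E₁ (j + 1) ≤ E₂) (h₀ : ∀ n, ∑' j, E₀ (n + j + 1) ≤ E₁ n) :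
    Tendsto E₀ atTop (𝓝 0) := by
  -- the middle weights, shifted by one, are summable, hence tend to zero; so do the unshifted ones
  have hsum : ∑' j, E₁ (j + 1) ≠ ⊤ := ne_top_of_le_ne_top hfin h₁
  have hE₁' : Tendsto (fun j => E₁ (j + 1)) atTop (𝓝 0) :=
    ENNReal.tendsto_atTop_zero_of_tsum_ne_top hsum
  have hE₁ : Tendsto E₁ atTop (𝓝 0) := (tendsto_add_atTop_iff_nat 1).mp hE₁'
  -- each bottom weight (shifted by one) is a term of a tail sum, hence below the middle weight
  have hle : ∀ n, E₀ (n + 1) ≤ E₁ n := fun n =>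
    (ENNReal.le_tsum (f := fun j => E₀ (n + j + 1)) 0).trans (h₀ n)
  have hE₀' : Tendsto (fun n => E₀ (n + 1)) atTop (𝓝 0) :=
    tendsto_of_tendsto_of_tendsto_of_le_of_le tendsto_const_nhds hE₁ (fun _ => zero_le) hle
  exact (tendsto_add_atTop_iff_nat 1).mp hE₀'

end Summit.FinalStateConjecture.FinalStateConjecture.Cruxes.GapExhaustion.StrategyR1

end
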